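import Summits.AtomisticToContinuum.BoseEinsteinCondensation.Theses.BECDispersionLadder
import Summits.AtomisticToContinuum.BoseEinsteinCondensation.Theorems.BECDispersionLadderEndpointTransferTruncation
import HarnessLib

/-!
# Route `BECDispersionLadder`, support item `EndpointTransfer` (stmt-AtomisticToContinuum-14557), IIb:
# continuity of the ground-state energy of the dial at its endpoint, bounded interaction

Helper file (supports, does not close, stmt-AtomisticToContinuum-14557). For `L > 0`, a measurable profile
`w` whose periodic interaction `W = ∑_{i<j} w^per(xᵢ - xⱼ)` is BOUNDED on configurations, and every `ε > 0`,

  `∃ α₁ < 2, ∀ α ∈ [α₁, 2), E^per(w; N, L) ≤ E_α(w; N, L) + ε`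

(`energyContinuity_of_bounded`), where `E_α = fracPeriodicGroundStateEnergy α w N L` is the infimum of the
route's fractional energy over the periodic `C¹` Bose core and `E^per = periodicGroundStateEnergy w N L`.
Together with the tree's `limsup_{α↑2} E_α ≤ E^per` (`BoseGas.limsup_fracPeriodicGroundStateEnergy_le`) this is
`E_α → E^per` as `α ↑ 2` at fixed volume — the energy-continuity half of the item's mechanism, here for bounded
interactions; the hard-core case is reduced to this one and to the maximal-form bound in part III.

Proof (no compactness): take a near-minimiser `Ψ` of `E_α`, embed it in `L²((ℝ/ℤ)^{3N})` (free form domain,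
`f = ι(graphEmbed Ψ)`, coefficients `c_ν = ⟪e_ν, f⟫`) and TRUNCATE in momentum space to the box
`F_R = {|ν_{i,k}| ≤ R}`, `g = ∑_{ν ∈ F_R} c_ν e_ν` (Bose-symmetric). By part I the `α`-kinetic energy of `Ψ` is
`∑_ν (∑ᵢ|2πνᵢ/L|^α)|c_ν|²`; off the box the weight is `≥ 2π(R+1)/L`, so `‖f - g‖² ≤ E_α[Ψ]·L/(2π(R+1))`
uniformly in `α ∈ [1,2]`; on the box `|k|² ≤ max(1,(6πR/L)^{2-α})|k|^α`, a factor `→ 1` as `α ↑ 2` at fixed `R`;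
and since `W ≤ M`, `∫ W|g|² ≤ ∫ W|f|² + M(‖g-f‖² + 2‖g-f‖)`. The tree's maximal-form bound for integrable
interactions (`BoseGas.periodicGroundStateEnergy_mul_le_maxForm`, Simon's form-core theorem in the Bose sector)
gives `E^per ‖g‖² ≤ Q_w(g)`, and `‖g‖² ≥ 1 - 2‖f-g‖`; choosing `R` and then `α₁` closes the estimate.

References: B. Simon, *J. Operator Theory* 1 (1979) 37–47 (form cores); [ReedSimonIV1978] Thm XIII.64.
-/

noncomputable section

open MeasureTheory Filter UnitAddTorus Complex
open scoped ENNReal NNReal BigOperators Topology InnerProductSpace ComplexConjugate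

namespace Summit.AtomisticToContinuum.BoseEinsteinCondensation.Theorems

open Literature.MathematicalPhysics.QuantumManyBody.BoseGas
open Summit.AtomisticToContinuum.BoseEinsteinCondensation.Cruxes.StaticResponseBound.UvThomsonForceWave

-- The measure on `ℝ/ℤ` is the Haar PROBABILITY measure, as in `PeriodicFormDomain.lean`.
attribute [local instance] Literature.MathematicalPhysics.QuantumManyBody.BoseGas.formDomain_measureSpace
  Literature.MathematicalPhysics.QuantumManyBody.BoseGas.formDomain_isProbabilityMeasure
  Literature.MathematicalPhysics.QuantumManyBody.BoseGas.formDomain_isProbabilityMeasure_pi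

namespace EndpointTransfer

variable {N : ℕ} {L : ℝ}

/-! ### The one-shot comparison through a momentum truncation -/

/-- **The one-shot comparison.** For a bounded measurable interaction `W ≤ M`, `1 ≤ α ≤ 2`, a box size `R`
with `L ≤ 2π(R+1)` and a periodic trial state `Ψ` with `E_α[Ψ] ≤ B < ⊤`:
`E^per ≤ ρ E_α[Ψ] + (M + E^per)(θ + 2√θ)` with `ρ = max(1, (6πR/L)^{2-α})` and `θ = B L/(2π(R+1))`
(momentum truncation of the embedded class to the box, the tree's maximal-form bound at the truncation, and
`‖g‖² ≥ 1 - 2‖f - g‖`). [folklore] -/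
theorem groundState_le_frac_core (hL : 0 < L) {w : ℝ → ℝ≥0∞} (hw : Measurable w) {M : ℝ≥0}
    (hM : ∀ X : Config N, periodicInteraction w L X ≤ M) {α : ℝ} (hα1 : 1 ≤ α) (hα2 : α ≤ 2)
    {R : ℕ} (hR : L ≤ 2 * Real.pi * (R + 1)) {B : ℝ≥0∞} (hB : B ≠ ⊤) (Ψ : PeriodicTrialState N L)
    (hΨ : fracPeriodicEnergy α w N L Ψ.ψ ≤ B) :
    periodicGroundStateEnergy w N L ≤
      ENNReal.ofReal (max 1 ((2 * Real.pi / L * (3 * R)) ^ (2 - α))) * fracPeriodicEnergy α w N L Ψ.ψ +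
        (M + periodicGroundStateEnergy w N L) *
          ENNReal.ofReal (B.toReal * (L / (2 * Real.pi * (R + 1))) +
            2 * Real.sqrt (B.toReal * (L / (2 * Real.pi * (R + 1))))) := by
  set E₂ := periodicGroundStateEnergy w N L with hE₂
  set ρ : ℝ := max 1 ((2 * Real.pi / L * (3 * R)) ^ (2 - α)) with hρ
  have hρ1 : 1 ≤ ρ := le_max_left _ _
  set θ : ℝ := B.toReal * (L / (2 * Real.pi * (R + 1))) with hθ
  have hθ0 : 0 ≤ θ := by positivity
  -- the embedded class, its coefficients and its truncation to the box
  set f : Lp ℂ 2 (volume : Measure (UnitAddTorus (Fin N × Fin 3))) :=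
    formEmbed hL measurable_zeroProfile (lintegral_periodicInteraction_zero_ne_top N L)
      ⟨graphEmbed hL measurable_zeroProfile (lintegral_periodicInteraction_zero_ne_top N L)
        ⟨Ψ.ψ, Ψ.mem_periodicCore⟩, graphEmbed_mem_formDomain _ _ _ _⟩ with hf
  have hf1 : ‖f‖ = 1 :=
    norm_formEmbed_graphEmbed_trialState hL measurable_zeroProfile (lintegral_periodicInteraction_zero_ne_top N L) Ψ
  set g : Lp ℂ 2 (volume : Measure (UnitAddTorus (Fin N × Fin 3))) :=
    ∑ ν ∈ lowFreq N R, ⟪(mFourierLp 2 ν : Lp ℂ 2 (volume : Measure (UnitAddTorus (Fin N × Fin 3)))), f⟫_ℂ •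
      (mFourierLp 2 ν : Lp ℂ 2 (volume : Measure (UnitAddTorus (Fin N × Fin 3)))) with hg
  -- kinetic and potential parts of `E_α[Ψ]` through `f`
  set KIN : ℝ≥0∞ := ∑' ν : Fin N × Fin 3 → ℤ, (∑ i : Fin N, fracDispersion α L (fun k => ν (i, k))) *
    (‖⟪(mFourierLp 2 ν : Lp ℂ 2 (volume : Measure (UnitAddTorus (Fin N × Fin 3)))), f⟫_ℂ‖₊ : ℝ≥0∞) ^ 2 with hKIN
  set POT : ℝ≥0∞ := ∫⁻ t, periodicInteraction w L (fromUnitTorusN L t) *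
    (‖(f : UnitAddTorus (Fin N × Fin 3) → ℂ) t‖₊ : ℝ≥0∞) ^ 2 with hPOT
  have hWmeas : Measurable (periodicInteraction (N := N) w L) := measurable_periodicInteraction_trunc hw L
  have hE : fracPeriodicEnergy α w N L Ψ.ψ = KIN + POT := by
    rw [fracPeriodicEnergy_apply, fracKinetic_eq_tsum_inner hL Ψ α, ← lintegral_pot_formEmbed_trialState hL Ψ hWmeas]
  have hKIN_le : KIN ≤ B := le_trans le_self_add (hE ▸ hΨ)
  -- the tail: `s² ≤ θ`
  set s : ℝ := ‖g - f‖ with hs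
  have hs0 : 0 ≤ s := norm_nonneg _
  have htail : ENNReal.ofReal (2 * Real.pi * (R + 1) / L) * ENNReal.ofReal (s ^ 2) ≤ KIN := by
    rw [hs, norm_sub_rev, hg, ofReal_norm_sub_trunc_sq f (lowFreq N R)]
    exact mul_tsum_tail_le (lowFreq N R) (fun ν hν => le_sum_fracDispersion_of_not_mem_lowFreq hL hα1 hR hν) _
  have hs2 : s ^ 2 ≤ θ := by
    have hpos : (0 : ℝ) < 2 * Real.pi * (R + 1) / L := by positivity
    have h1 : ENNReal.ofReal (s ^ 2) ≤ (ENNReal.ofReal (2 * Real.pi * (R + 1) / L))⁻¹ * B :=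
      (ENNReal.mul_le_iff_le_inv ((ENNReal.ofReal_pos.2 hpos).ne') ENNReal.ofReal_ne_top).1 (htail.trans hKIN_le)
    have h2 : (ENNReal.ofReal (2 * Real.pi * (R + 1) / L))⁻¹ * B = ENNReal.ofReal θ := by
      rw [← ENNReal.ofReal_inv_of_pos hpos, inv_div, hθ, mul_comm B.toReal,
        ENNReal.ofReal_mul (by positivity : (0 : ℝ) ≤ L / (2 * Real.pi * (R + 1))), ENNReal.ofReal_toReal hB]
    exact (ENNReal.ofReal_le_ofReal_iff hθ0).1 (h1.trans_eq h2)
  have hsθ : s ≤ Real.sqrt θ := Real.le_sqrt_of_sq_le hs2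
  -- Bose symmetry of `f` and of its truncation
  have hfsymm : ∀ (σ : Equiv.Perm (Fin N)) (n : Fin N × Fin 3 → ℤ),
      ⟪(mFourierLp 2 (fun p : Fin N × Fin 3 => n (σ p.1, p.2)) : Lp ℂ 2 (volume : Measure (UnitAddTorus (Fin N × Fin 3)))), f⟫_ℂ =
        ⟪(mFourierLp 2 n : Lp ℂ 2 (volume : Measure (UnitAddTorus (Fin N × Fin 3)))), f⟫_ℂ := fun σ n => by
    rw [hf, inner_mFourierLp_formEmbed_trialState, inner_mFourierLp_formEmbed_trialState,
      configFourierCoeff_perm Ψ.symm]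
  have hgsymm := inner_symm_trunc f hfsymm R
  -- the tree's maximal-form bound at the truncation (integrable interaction)
  have hWint : ∫⁻ X in cellN N L, periodicInteraction w L X ≠ ⊤ := by
    refine ne_top_of_le_ne_top ?_ (lintegral_mono fun X => hM X)
    rw [setLIntegral_const, volume_cellN]
    exact ENNReal.mul_ne_top ENNReal.coe_ne_top (ENNReal.pow_ne_top (ENNReal.pow_ne_top ENNReal.ofReal_ne_top))
  have hmf := periodicGroundStateEnergy_mul_le_maxForm hL hw hWint g hgsymm
  -- the kinetic energy of the truncation
  have hcoef : ∀ ν : Fin N × Fin 3 → ℤ, ⟪(mFourierLp 2 ν : Lp ℂ 2 (volume : Measure (UnitAddTorus (Fin N × Fin 3)))), g⟫_ℂ =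
      if ν ∈ lowFreq N R then ⟪(mFourierLp 2 ν : Lp ℂ 2 (volume : Measure (UnitAddTorus (Fin N × Fin 3)))), f⟫_ℂ else 0 :=
    fun ν => by rw [hg]; exact inner_mFourierLp_sum_smul _ _ ν
  have hkin_g : ∑' ν : Fin N × Fin 3 → ℤ, ENNReal.ofReal (∑ q, (2 * Real.pi * (ν q : ℝ) / L) ^ 2) *
      (‖⟪(mFourierLp 2 ν : Lp ℂ 2 (volume : Measure (UnitAddTorus (Fin N × Fin 3)))), g⟫_ℂ‖₊ : ℝ≥0∞) ^ 2 ≤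
      ENNReal.ofReal ρ * KIN := by
    rw [hKIN, ← ENNReal.tsum_mul_left]
    refine ENNReal.tsum_le_tsum fun ν => ?_
    rw [hcoef ν, ← sum_fracDispersion_two]
    split_ifs with hν
    · rw [← mul_assoc]
      gcongr
      exact sum_fracDispersion_two_le_mul hL hα2 hν
    · simp
  -- the potential energy of the truncation
  have hpot_g : ∫⁻ t, periodicInteraction w L (fromUnitTorusN L t) *
      (‖(g : UnitAddTorus (Fin N × Fin 3) → ℂ) t‖₊ : ℝ≥0∞) ^ 2 ≤ POT + M * ENNReal.ofReal (s ^ 2 + 2 * s) := by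
    have h := lintegral_weight_sq_le_add (W := fun t => periodicInteraction w L (fromUnitTorusN L t))
      (hWmeas.comp (measurable_fromUnitTorusN L)) (M := (M : ℝ≥0∞)) (fun t => hM _) f g
    rw [hf1, mul_one] at h
    exact h
  -- the norm of the truncation from below: `1 ≤ ‖g‖² + 2s`
  have hg_norm : (1 : ℝ) ≤ ‖g‖ ^ 2 + 2 * s := by
    have hrev : 1 - s ≤ ‖g‖ := by
      have h := norm_sub_norm_le f g
      rw [hf1, norm_sub_rev] at h
      linarith
    rcases le_or_gt (1 / 2 : ℝ) s with h | h
    · nlinarith [sq_nonneg ‖g‖]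
    · have h2 := mul_self_le_mul_self (by linarith : 0 ≤ 1 - s) hrev
      nlinarith [h2]
  -- assemble
  have hρE : ENNReal.ofReal ρ * KIN + POT ≤ ENNReal.ofReal ρ * (KIN + POT) := by
    rw [mul_add]
    gcongr
    exact le_mul_of_one_le_left bot_le (by rw [← ENNReal.ofReal_one]; exact ENNReal.ofReal_le_ofReal hρ1)
  have h2s : ENNReal.ofReal (2 * s) ≤ ENNReal.ofReal (s ^ 2 + 2 * s) := ENNReal.ofReal_le_ofReal (by nlinarith)
  have hsmall : ENNReal.ofReal (s ^ 2 + 2 * s) ≤ ENNReal.ofReal (θ + 2 * Real.sqrt θ) :=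
    ENNReal.ofReal_le_ofReal (by nlinarith)
  calc E₂ = E₂ * 1 := (mul_one _).symm
    _ ≤ E₂ * ENNReal.ofReal (‖g‖ ^ 2 + 2 * s) := by
        gcongr
        rw [← ENNReal.ofReal_one]
        exact ENNReal.ofReal_le_ofReal hg_norm
    _ = E₂ * ENNReal.ofReal (‖g‖ ^ 2) + E₂ * ENNReal.ofReal (2 * s) := by
        rw [ENNReal.ofReal_add (sq_nonneg _) (mul_nonneg zero_le_two hs0), mul_add]
    _ ≤ (ENNReal.ofReal ρ * KIN + (POT + M * ENNReal.ofReal (s ^ 2 + 2 * s))) +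
          E₂ * ENNReal.ofReal (s ^ 2 + 2 * s) := by
        gcongr ?_ + E₂ * ?_
        exact hmf.trans (add_le_add hkin_g hpot_g)
    _ = (ENNReal.ofReal ρ * KIN + POT) + (M + E₂) * ENNReal.ofReal (s ^ 2 + 2 * s) := by ring
    _ ≤ ENNReal.ofReal ρ * (KIN + POT) + (M + E₂) * ENNReal.ofReal (θ + 2 * Real.sqrt θ) := by
        gcongr
    _ = _ := by rw [← hE]

/-! ### Energy continuity at the endpoint, bounded interaction -/

/-- **Continuity of the ground-state energy of the dial at `α = 2`, bounded interaction.** For `L > 0`, a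
measurable profile `w` with bounded periodic interaction `W ≤ M` and `ε > 0` there is `α₁ < 2` with
`E^per(w; N, L) ≤ E_α(w; N, L) + ε` for all `α ∈ [α₁, 2)`: first the box size `R` (the tail and the potential
perturbation are uniform in `α ∈ [1, 2]`), then `α₁` (the kinetic ratio `max(1,(6πR/L)^{2-α}) → 1`).
[folklore] -/
theorem energyContinuity_of_bounded (hL : 0 < L) {w : ℝ → ℝ≥0∞} (hw : Measurable w) {M : ℝ≥0}
    (hM : ∀ X : Config N, periodicInteraction w L X ≤ M) {ε : ℝ≥0∞} (hε : 0 < ε) :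
    ∃ α₁ : ℝ, α₁ < 2 ∧ ∀ α : ℝ, α₁ ≤ α → α < 2 →
      periodicGroundStateEnergy w N L ≤ fracPeriodicGroundStateEnergy α w N L + ε := by
  rcases eq_or_ne ε ⊤ with hεtop | hεtop
  · exact ⟨1, by norm_num, fun α _ _ => by rw [hεtop, add_top]; exact le_top⟩
  set E₂ := periodicGroundStateEnergy w N L with hE₂
  -- the empty trial class: both sides are `⊤`
  rcases isEmpty_or_nonempty (PeriodicTrialState N L) with hemp | ⟨⟨Ψ₀⟩⟩
  · refine ⟨1, by norm_num, fun α _ _ => ?_⟩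
    have h : fracPeriodicGroundStateEnergy α w N L = ⊤ := iInf_of_empty _
    rw [h, top_add]
    exact le_top
  -- finiteness
  have hWint : ∫⁻ X in cellN N L, periodicInteraction w L X ≠ ⊤ := by
    refine ne_top_of_le_ne_top ?_ (lintegral_mono fun X => hM X)
    rw [setLIntegral_const, volume_cellN]
    exact ENNReal.mul_ne_top ENNReal.coe_ne_top (ENNReal.pow_ne_top (ENNReal.pow_ne_top ENNReal.ofReal_ne_top))
  have hE₂fin : E₂ ≠ ⊤ :=
    ne_top_of_le_ne_top (lintegral_energy_lt_top hw hWint Ψ₀.contDiff).ne (periodicGroundStateEnergy_le w Ψ₀)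
  set B : ℝ≥0∞ := (N : ℝ≥0∞) + E₂ + 1 with hB
  have hBfin : B ≠ ⊤ := by simp [hB, hE₂fin]
  have hME : (M : ℝ≥0∞) + E₂ ≠ ⊤ := by simp [hE₂fin]
  -- `ε/3`
  set ε₃ : ℝ≥0∞ := ε / 3 with hε₃
  have hε₃pos : 0 < ε₃ := ENNReal.div_pos hε.ne' (by norm_num)
  -- Step 1: the box size `R`
  obtain ⟨R, hR1, hR2⟩ : ∃ R : ℕ, L ≤ 2 * Real.pi * (R + 1) ∧
      ((M : ℝ≥0∞) + E₂) * ENNReal.ofReal (B.toReal * (L / (2 * Real.pi * (R + 1))) +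
        2 * Real.sqrt (B.toReal * (L / (2 * Real.pi * (R + 1))))) ≤ ε₃ := by
    have h1 : Tendsto (fun R : ℕ => 2 * Real.pi * ((R : ℝ) + 1)) atTop atTop :=
      (tendsto_atTop_add_const_right _ _ tendsto_natCast_atTop_atTop).const_mul_atTop (by positivity)
    have h2 : Tendsto (fun R : ℕ => B.toReal * (L / (2 * Real.pi * ((R : ℝ) + 1)))) atTop (𝓝 0) := by
      have h := ((tendsto_const_nhds (x := L)).div_atTop h1).const_mul B.toReal
      rwa [mul_zero] at h
    have h3 : Tendsto (fun R : ℕ => B.toReal * (L / (2 * Real.pi * ((R : ℝ) + 1))) +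
        2 * Real.sqrt (B.toReal * (L / (2 * Real.pi * ((R : ℝ) + 1))))) atTop (𝓝 0) := by
      have hs := (Real.continuous_sqrt.tendsto 0).comp h2
      rw [Real.sqrt_zero] at hs
      have h := h2.add (hs.const_mul 2)
      rw [mul_zero, add_zero] at h
      exact h
    have h4 : Tendsto (fun R : ℕ => ((M : ℝ≥0∞) + E₂) * ENNReal.ofReal (B.toReal * (L / (2 * Real.pi * ((R : ℝ) + 1))) +
        2 * Real.sqrt (B.toReal * (L / (2 * Real.pi * ((R : ℝ) + 1)))))) atTop (𝓝 0) := by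
      have h := ENNReal.Tendsto.const_mul (ENNReal.tendsto_ofReal h3) (Or.inr hME)
      rwa [ENNReal.ofReal_zero, mul_zero] at h
    obtain ⟨R, hRa, hRb⟩ := ((h1.eventually_ge_atTop L).and ((tendsto_order.1 h4).2 ε₃ hε₃pos)).exists
    exact ⟨R, hRa, hRb.le⟩
  -- Step 2: `α₁` from the kinetic ratio `ρ(R, α) → 1`
  set T : ℝ := 2 * Real.pi / L * (3 * R) with hT
  have hT0 : 0 ≤ T := by positivity
  obtain ⟨δ, hδ, hρ⟩ : ∃ δ : ℝ, 0 < δ ∧ ∀ α : ℝ, 2 - δ < α → α < 2 →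
      ENNReal.ofReal (max 1 (T ^ (2 - α)) - 1) * B ≤ ε₃ := by
    rcases eq_or_lt_of_le hT0 with hT00 | hTpos
    · refine ⟨1, one_pos, fun α _ hα2 => ?_⟩
      rw [← hT00, Real.zero_rpow (by linarith), max_eq_left zero_le_one, sub_self, ENNReal.ofReal_zero, zero_mul]
      exact bot_le
    · have hcont : Tendsto (fun α : ℝ => ENNReal.ofReal (max 1 (T ^ (2 - α)) - 1) * B) (𝓝 2) (𝓝 0) := by
        have h1 : Tendsto (fun α : ℝ => T ^ (2 - α)) (𝓝 2) (𝓝 1) := by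
          have hc : ContinuousAt (fun x : ℝ => T ^ x) 0 := Real.continuousAt_const_rpow hTpos.ne'
          have h2 : Tendsto (fun α : ℝ => 2 - α) (𝓝 2) (𝓝 0) := by
            have h := (tendsto_const_nhds (x := (2 : ℝ)) (f := 𝓝 (2 : ℝ))).sub (tendsto_id (x := 𝓝 (2 : ℝ)))
            rw [sub_self] at h
            exact h
          have h := hc.tendsto.comp h2
          rwa [Real.rpow_zero] at h
        have h3 : Tendsto (fun α : ℝ => max 1 (T ^ (2 - α)) - 1) (𝓝 2) (𝓝 0) := by
          have hmax : Continuous fun x : ℝ => max 1 x := continuous_const.max continuous_id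
          have h := ((hmax.tendsto 1).comp h1).sub_const 1
          rw [max_self, sub_self] at h
          exact h
        have h4 := ENNReal.Tendsto.mul_const (ENNReal.tendsto_ofReal h3) (Or.inr hBfin)
        rwa [ENNReal.ofReal_zero, zero_mul] at h4
      obtain ⟨δ, hδ, hball⟩ := Metric.eventually_nhds_iff.1 ((tendsto_order.1 hcont).2 ε₃ hε₃pos)
      refine ⟨δ, hδ, fun α h1 h2 => (hball ?_).le⟩
      rw [Real.dist_eq, abs_sub_lt_iff]
      constructor <;> linarith
  -- the threshold
  refine ⟨max 1 (2 - δ / 2), max_lt (by norm_num) (by linarith), fun α hα1 hα2 => ?_⟩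
  have hα_one : 1 ≤ α := le_trans (le_max_left _ _) hα1
  have hαδ : 2 - δ < α := lt_of_lt_of_le (by linarith [le_max_right 1 (2 - δ / 2)]) hα1
  set mα := fracPeriodicGroundStateEnergy α w N L with hmα
  rcases eq_or_ne mα ⊤ with hmtop | hmtop
  · rw [hmtop, top_add]; exact le_top
  -- a near-minimiser of `E_α`
  set ε₁ : ℝ≥0∞ := min ε₃ 1 with hε₁
  have hε₁pos : 0 < ε₁ := lt_min hε₃pos zero_lt_one
  obtain ⟨Ψ, hΨ⟩ : ∃ Ψ : PeriodicTrialState N L, fracPeriodicEnergy α w N L Ψ.ψ ≤ mα + ε₁ := by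
    obtain ⟨Ψ, h⟩ := iInf_lt_iff.1 (ENNReal.lt_add_right hmtop hε₁pos.ne')
    exact ⟨Ψ, h.le⟩
  have hmαB : mα + ε₁ ≤ B :=
    add_le_add (fracPeriodicGroundStateEnergy_le_add (by linarith) hα2.le hL w) (min_le_right _ _)
  have hcore := groundState_le_frac_core hL hw hM hα_one hα2.le hR1 hBfin Ψ (hΨ.trans hmαB)
  -- `ρ E_α[Ψ] ≤ (mα + ε₁) + (ρ - 1) B`
  set ρ : ℝ := max 1 (T ^ (2 - α)) with hρdef
  have hρ1 : 1 ≤ ρ := le_max_left _ _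
  have hρeq : ENNReal.ofReal ρ = ENNReal.ofReal (ρ - 1) + 1 := by
    rw [← ENNReal.ofReal_one, ← ENNReal.ofReal_add (by linarith) zero_le_one, sub_add_cancel]
  have hsplit : ENNReal.ofReal ρ * fracPeriodicEnergy α w N L Ψ.ψ ≤ (mα + ε₁) + ENNReal.ofReal (ρ - 1) * B :=
    calc ENNReal.ofReal ρ * fracPeriodicEnergy α w N L Ψ.ψ ≤ ENNReal.ofReal ρ * (mα + ε₁) := by gcongr
      _ = (mα + ε₁) + ENNReal.ofReal (ρ - 1) * (mα + ε₁) := by rw [hρeq, add_mul, one_mul, add_comm]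
      _ ≤ (mα + ε₁) + ENNReal.ofReal (ρ - 1) * B := by gcongr
  calc E₂ ≤ _ := hcore
    _ ≤ ((mα + ε₁) + ENNReal.ofReal (ρ - 1) * B) + ε₃ := add_le_add hsplit hR2
    _ ≤ ((mα + ε₃) + ε₃) + ε₃ := by
        gcongr
        · exact min_le_left _ _
        · exact hρ α hαδ hα2
    _ = mα + ε := by rw [hε₃, add_assoc, add_assoc, ← add_assoc (ε / 3), ENNReal.add_thirds]

end EndpointTransfer

end Summit.AtomisticToContinuum.BoseEinsteinCondensation.Theorems

end
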